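import Summits.ValiantsHypothesis.ValiantsHypothesis.Theorems.BarrierLeverPriorityPeelingCertificateExamples
import Summits.ValiantsHypothesis.ValiantsHypothesis.Theorems.BarrierLeverResultantKernelSufficesForTransversal

/-!
# Route BarrierLever — priority peeling for TT: layouts of small rank are PP-derivable

Helper file (`--supports stmt-ValiantsHypothesis-19761`; cell valiant-natproofs, rung V4, 𝒟-side door
(c); prover val-np-p1 g7). Closes NO item. Generic pieces of the «small-`h` rungs» of item 19761
`PriorityPeelingCertificatesExist` (every injective TT layout has a priority-peeling derivation
`PriorityPeeling.PPDerivable`, p460060, which by the bridge p467389 puts it in every predicate closed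
under the item's clauses):

* `exists_perm_of_forall_exists`, `ppDerivable_of_perm` — re-indexing reduction: an injective index map
  whose values lie among those of a fixed map is that map composed with a permutation, and
  `PPDerivable.reindex` transports derivations along it;
* `mem_iff_of_ttRow_eq`, `mem_iff_of_ttCol_eq` — a TT literal determines membership (the literal maps
  `a ↦ castAdd h a / natAdd h a` by `a ∈ u i`, columns the other way round, are injective by the tree
  lemmas `ResultantKernel.rowT_injective` / `colT_injective`, p418637);
* `ppDerivable_layout_r0` / `_r1` / `_r2` — layouts with at most TWO rows are derivable for every `h`
  (two rows: one pair move along a coordinate where the rows differ, the two columns split by a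
  coordinate where they differ, children = single rows);
* `ppDerivable_layout_h0`, `ppDerivable_layout_h1` — every injective layout with `h ≤ 1`, every `r`.

The `h = 2` rung and the slices of items 19761 / 19152 it yields are in the sibling file
`…PriorityPeelingLayoutsUpToTwo`.

WHAT THIS IS NOT: small cases only; nothing on 19761 / TT (19152) in general, on crux
stmt-ValiantsHypothesis-14610, or on VP versus VNP.
-/

-- layout Summits/ValiantsHypothesis/ValiantsHypothesis forces the duplicated namespace component
set_option linter.dupNamespace false

namespace Summit.ValiantsHypothesis.ValiantsHypothesis.Theorems.BarrierLever.PPSmall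

open Summit.ValiantsHypothesis.ValiantsHypothesis.Theorems.BarrierLever.PriorityPeeling

/-! ## 1. Generic reductions -/

/-- If every value of `u` is a value of `v` and `u : Fin r → α` is injective, then `u = v ∘ σ` for a
permutation `σ` of `Fin r`. -/
theorem exists_perm_of_forall_exists {r : ℕ} {α : Type*} {u v : Fin r → α}
    (h : ∀ i, ∃ j, u i = v j) (hu : Function.Injective u) :
    ∃ σ : Equiv.Perm (Fin r), ∀ i, u i = v (σ i) := by
  choose g hg using h
  have hginj : Function.Injective g := fun i j hij => hu (by rw [hg i, hg j, hij])
  exact ⟨Equiv.ofBijective g (Finite.injective_iff_bijective.mp hginj), fun i => hg i⟩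

/-- Re-indexing: a configuration whose rows / columns are those of a derivable configuration read
through permutations is derivable (`PPDerivable.reindex`). -/
theorem ppDerivable_of_perm {nr nc r e : ℕ} (R R₀ : Fin r → Fin e → Fin nr)
    (C C₀ : Fin r → Fin e → Fin nc) (σ τ : Equiv.Perm (Fin r)) (hR : ∀ i, R i = R₀ (σ i))
    (hC : ∀ j, C j = C₀ (τ j)) (h₀ : PPDerivable nr nc (Fin r) e R₀ C₀) :
    PPDerivable nr nc (Fin r) e R C := by
  refine PPDerivable.reindex R C σ.symm τ.symm ?_
  have e1 : (fun i => R (σ.symm i)) = R₀ := funext fun i => by rw [hR, Equiv.apply_symm_apply]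
  have e2 : (fun j => C (τ.symm j)) = C₀ := funext fun j => by rw [hC, Equiv.apply_symm_apply]
  rw [e1, e2]
  exact h₀

/-- A TT row literal determines membership: the row maps of `s`, `t` agree at `a` iff `a ∈ s ↔ a ∈ t`. -/
theorem mem_iff_of_ttRow_eq (h : ℕ) (s t : Finset (Fin h)) (a : Fin h)
    (hab : (if a ∈ s then Fin.castAdd h a else Fin.natAdd h a) =
      (if a ∈ t then Fin.castAdd h a else Fin.natAdd h a)) : a ∈ s ↔ a ∈ t := by
  have hv := congrArg Fin.val hab
  by_cases ha : a ∈ s <;> by_cases hb : a ∈ t <;>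
    simp only [ha, hb, if_true, if_false, Fin.val_castAdd, Fin.val_natAdd, iff_true, iff_false,
      not_true] at hv ⊢ <;> omega

/-- Column version of `mem_iff_of_ttRow_eq`. -/
theorem mem_iff_of_ttCol_eq (h : ℕ) (s t : Finset (Fin h)) (c : Fin h)
    (hab : (if c ∈ s then Fin.natAdd h c else Fin.castAdd h c) =
      (if c ∈ t then Fin.natAdd h c else Fin.castAdd h c)) : c ∈ s ↔ c ∈ t := by
  have hv := congrArg Fin.val hab
  by_cases ha : c ∈ s <;> by_cases hb : c ∈ t <;>
    simp only [ha, hb, if_true, if_false, Fin.val_castAdd, Fin.val_natAdd, iff_true, iff_false,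
      not_true] at hv ⊢ <;> omega

/-! ## 2. At most two rows (every `h`) -/

/-- No rows. -/
theorem ppDerivable_layout_r0 (h : ℕ) (u w : Fin 0 → Finset (Fin h)) :
    PPDerivable (h + h) (h + h) (Fin 0) h
      (fun i a => if a ∈ u i then Fin.castAdd h a else Fin.natAdd h a)
      (fun j c => if c ∈ w j then Fin.natAdd h c else Fin.castAdd h c) := by
  rcases h with _ | n
  · exact PPDerivable.rank_zero _ _
  · exact PPDerivable.of_isEmpty (Fin.castAdd (n + 1) 0) (Fin.natAdd (n + 1) 0)
      (fun h => by have hv := congrArg Fin.val h; simp at hv) (n + 1) (Fin 0) _ _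

/-- One row. -/
theorem ppDerivable_layout_r1 (h : ℕ) (u w : Fin 1 → Finset (Fin h)) :
    PPDerivable (h + h) (h + h) (Fin 1) h
      (fun i a => if a ∈ u i then Fin.castAdd h a else Fin.natAdd h a)
      (fun j c => if c ∈ w j then Fin.natAdd h c else Fin.castAdd h c) :=
  PPDerivable.single _ _ 0 (fun i => Subsingleton.elim i 0) (ResultantKernel.rowT_injective h (u 0))
    (ResultantKernel.colT_injective h (w 0))

/-- Two rows: distinct rows and distinct columns suffice (one pair move along a coordinate `a` with
`a ∈ u 0 ↔ a ∉ u 1`, the two columns split by a coordinate `c` with `c ∈ w 0 ↔ c ∉ w 1`; both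
children are single rows). -/
theorem ppDerivable_layout_r2 (h : ℕ) (u w : Fin 2 → Finset (Fin h)) (hu : Function.Injective u)
    (hw : Function.Injective w) :
    PPDerivable (h + h) (h + h) (Fin 2) h
      (fun i a => if a ∈ u i then Fin.castAdd h a else Fin.natAdd h a)
      (fun j c => if c ∈ w j then Fin.natAdd h c else Fin.castAdd h c) := by
  -- a coordinate where the rows differ and one where the columns differ
  have hu01 : u 0 ≠ u 1 := fun e => absurd (hu e) (by decide)
  have hw01 : w 0 ≠ w 1 := fun e => absurd (hw e) (by decide)
  obtain ⟨a, ha⟩ : ∃ a : Fin h, ¬ (a ∈ u 0 ↔ a ∈ u 1) := by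
    by_contra hcon
    push Not at hcon
    exact hu01 (Finset.ext hcon)
  obtain ⟨c, hc⟩ : ∃ c : Fin h, ¬ (c ∈ w 0 ↔ c ∈ w 1) := by
    by_contra hcon
    push Not at hcon
    exact hw01 (Finset.ext hcon)
  rcases h with _ | n
  · exact Fin.elim0 a
  -- the split literals
  set ℓ₀ : Fin (n + 1 + (n + 1)) := if a ∈ u 0 then Fin.castAdd (n + 1) a else Fin.natAdd (n + 1) a
    with hℓ₀
  set ℓ₁ : Fin (n + 1 + (n + 1)) := if a ∈ u 1 then Fin.castAdd (n + 1) a else Fin.natAdd (n + 1) a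
    with hℓ₁
  set x : Fin (n + 1 + (n + 1)) := if c ∈ w 0 then Fin.natAdd (n + 1) c else Fin.castAdd (n + 1) c
    with hx
  set y : Fin (n + 1 + (n + 1)) := if c ∈ w 1 then Fin.natAdd (n + 1) c else Fin.castAdd (n + 1) c
    with hy
  have hℓ : ℓ₀ ≠ ℓ₁ := fun e => ha (mem_iff_of_ttRow_eq (n + 1) (u 0) (u 1) a e)
  have hxy : x ≠ y := fun e => hc (mem_iff_of_ttCol_eq (n + 1) (w 0) (w 1) c e)
  -- literals of other coordinates differ from the coordinate-`a` / coordinate-`c` literals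
  have rowlit_ne : ∀ (s t : Finset (Fin (n + 1))) (b : Fin (n + 1)), b ≠ a →
      (if b ∈ s then Fin.castAdd (n + 1) b else Fin.natAdd (n + 1) b) ≠
        (if a ∈ t then Fin.castAdd (n + 1) a else Fin.natAdd (n + 1) a) := by
    intro s t b hb e
    have hv := congrArg Fin.val e
    apply hb
    apply Fin.ext
    by_cases h1 : b ∈ s <;> by_cases h2 : a ∈ t <;>
      simp only [h1, h2, if_true, if_false, Fin.val_castAdd, Fin.val_natAdd] at hv <;> omega
  have collit_ne : ∀ (s t : Finset (Fin (n + 1))) (b : Fin (n + 1)), b ≠ c →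
      (if b ∈ s then Fin.natAdd (n + 1) b else Fin.castAdd (n + 1) b) ≠
        (if c ∈ t then Fin.natAdd (n + 1) c else Fin.castAdd (n + 1) c) := by
    intro s t b hb e
    have hv := congrArg Fin.val e
    apply hb
    apply Fin.ext
    by_cases h1 : b ∈ s <;> by_cases h2 : c ∈ t <;>
      simp only [h1, h2, if_true, if_false, Fin.val_castAdd, Fin.val_natAdd] at hv <;> omega
  refine PPDerivable.pair _ _ ℓ₀ ℓ₁ hℓ (fun i => decide (i = 1)) (fun _ => a) ?_ ?_ {x} {y}
    (fun _ => 0) (fun j => decide (j = 1)) (fun _ => c) ?_ ?_ (Equiv.refl _) (fun _ => rfl) ?_ ?_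
  · -- hpos
    intro i
    fin_cases i
    · simp [hℓ₀]
    · simp [hℓ₁]
  · -- huniq
    intro i b hb
    fin_cases i
    · exact ⟨rowlit_ne _ _ b hb, rowlit_ne _ _ b hb⟩
    · exact ⟨rowlit_ne _ _ b hb, rowlit_ne _ _ b hb⟩
  · -- hφ₀ : column 0, marked set {x}
    intro j hj
    have hj0 : j = 0 := by
      fin_cases j
      · rfl
      · simp at hj
    subst hj0
    refine ⟨by simp [hx], fun q hq hqc => ?_⟩
    exact absurd (Finset.mem_singleton.mp hq) (collit_ne _ _ q hqc)
  · -- hφ₁ : column 1, avoids {x}, top literal y ∈ {y}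
    intro j hj
    have hj1 : j = 1 := by
      fin_cases j
      · simp at hj
      · rfl
    subst hj1
    refine ⟨fun q hq => ?_, by simp [hy], fun q hq hqc => ?_⟩
    · rw [Finset.mem_singleton] at hq
      by_cases hqc : q = c
      · subst hqc
        exact hxy (hy.trans hq).symm
      · exact collit_ne _ _ q hqc (hq.trans hx)
    · exact absurd (Finset.mem_singleton.mp hq) (collit_ne _ _ q hqc)
  · -- child 0 : the single row 0
    refine PPDerivable.single _ _ ⟨0, by decide⟩ (fun i => ?_) ?_ ?_
    · rcases i with ⟨i, hi⟩
      fin_cases i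
      · rfl
      · simp at hi
    · exact (ResultantKernel.rowT_injective (n + 1) (u 0)).comp (Fin.succAbove_right_injective)
    · exact (ResultantKernel.colT_injective (n + 1) (w 0)).comp (Fin.succAbove_right_injective)
  · -- child 1 : the single row 1
    refine PPDerivable.single _ _ ⟨1, by decide⟩ (fun i => ?_) ?_ ?_
    · rcases i with ⟨i, hi⟩
      fin_cases i
      · simp at hi
      · rfl
    · exact (ResultantKernel.rowT_injective (n + 1) (u 1)).comp (Fin.succAbove_right_injective)
    · exact (ResultantKernel.colT_injective (n + 1) (w 1)).comp (Fin.succAbove_right_injective)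

/-! ## 3. `h ≤ 1` -/

/-- `h = 0`: an injective layout has at most one row. -/
theorem ppDerivable_layout_h0 (r : ℕ) (u w : Fin r → Finset (Fin 0)) (hu : Function.Injective u) :
    PPDerivable (0 + 0) (0 + 0) (Fin r) 0
      (fun i a => if a ∈ u i then Fin.castAdd 0 a else Fin.natAdd 0 a)
      (fun j c => if c ∈ w j then Fin.natAdd 0 c else Fin.castAdd 0 c) := by
  have hr : r ≤ 1 := by
    have h1 := Fintype.card_le_of_injective u hu
    simpa [Fintype.card_fin, Fintype.card_finset] using h1
  rcases r with _ | _ | r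
  · exact ppDerivable_layout_r0 0 u w
  · exact ppDerivable_layout_r1 0 u w
  · omega

/-- `h = 1`: one coordinate; the rank-one leaf. -/
theorem ppDerivable_layout_h1 (r : ℕ) (u w : Fin r → Finset (Fin 1)) (hu : Function.Injective u)
    (hw : Function.Injective w) :
    PPDerivable (1 + 1) (1 + 1) (Fin r) 1
      (fun i a => if a ∈ u i then Fin.castAdd 1 a else Fin.natAdd 1 a)
      (fun j c => if c ∈ w j then Fin.natAdd 1 c else Fin.castAdd 1 c) := by
  refine PPDerivable.rank_one _ _ (fun i j hij => hu ?_) (fun i j hij => hw ?_)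
  · ext a
    have ha : a = 0 := Subsingleton.elim a 0
    subst ha
    exact mem_iff_of_ttRow_eq 1 (u i) (u j) 0 hij
  · ext c
    have hc : c = 0 := Subsingleton.elim c 0
    subst hc
    exact mem_iff_of_ttCol_eq 1 (w i) (w j) 0 hij

end Summit.ValiantsHypothesis.ValiantsHypothesis.Theorems.BarrierLever.PPSmall
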